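import Summits.RiemannHypothesis.RiemannHypothesis.Theorems.WeilFormatCWindowSummable
import Summits.RiemannHypothesis.RiemannHypothesis.Theorems.WeilFormatCWindowPolarization
import Summits.RiemannHypothesis.RiemannHypothesis.Theorems.WeilFormatCEntryBasis
import HarnessLib

/-!
# Format C, design C∞: Parseval for the summable window class (the `ℓ²` Gram of the profile coefficients)

Route context: Fourier–Galerkin / Schur-complement certificates of Weil positivity on a window ("format C";
cell memo `run/shared/lean/pub/rh-explicit/rh-explicit-weil-10/FORMATC-DESIGN.md` §9.12.9, KERNEL-LEVER.md §17 (a);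
supporting stmt-RiemannHypothesis-0098; seat rh-explicit-weil-10).  The correction clause of the deflated limit wrapper
(`WeilFormatCDeflatedFarLimit`, the `Cq` term) contains the `ℓ²` Gram `Σ_{n∈[B,P)} V_{nj} V_{nj'}` of the truncated profile
coefficient vectors; its limit `P → ∞` is identified here with `L²` inner products of the profile windows:

* `integral_sum_smul_chi_mul_conj` — finite orthonormality in sesquilinear form: `∫ (Σ_s c_nχ_n) conj(Σ_s d_mχ_m) = Σ_s c_n conj d_n`;
* `integral_proj_mul_conj_proj` — `∫ proj_P φ · conj(proj_P ψ) = Σ_{|n|≤P} ĉ_n(φ) conj ĉ_n(ψ)/(2a)`;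
* `tendsto_integral_proj_mul_conj_proj` — for windows of the summable class (zero off `[−a,a]`, continuous on it,
  matching endpoint values, `Σ|ĉ_n| < ∞`): `∫ proj_P φ · conj(proj_P ψ) → ∫ φ conj ψ` (dominated convergence);
* **`hasSum_fourierCoeff_mul_conj`** — Parseval: `Σ_{n∈ℤ} ĉ_n(φ) conj ĉ_n(ψ)/(2a) = ∫ φ conj ψ`, and the partial sums over
  `modes P` converge to it (`tendsto_sum_modes_fourierCoeff_mul_conj`).

Pure analysis bookkeeping; standard axioms; no RH claim.
-/

set_option autoImplicit false
-- `Summit.RiemannHypothesis.RiemannHypothesis.…` is the layout-mandated namespace (summit = problem name).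
set_option linter.dupNamespace false

noncomputable section

open Complex Filter Set MeasureTheory
open scoped Real Topology ComplexConjugate

namespace Summit.RiemannHypothesis.RiemannHypothesis.Theorems.WeilFormatC

open Literature.NumberTheory.LFunctions Literature.NumberTheory.LFunctions.Yoshida1992

variable {a : ℝ} {φ ψ : ℝ → ℂ}

/-! ## Finite orthonormality in sesquilinear form -/

/-- `∫ (Σ_{n∈s} c_n χ_n)(x) · conj((Σ_{m∈s} d_m χ_m)(x)) dx = Σ_{n∈s} c_n conj d_n` (`a > 0`). -/
theorem integral_sum_smul_chi_mul_conj (ha : 0 < a) (s : Finset ℤ) (c d : ℤ → ℂ) :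
    ∫ x, (∑ n ∈ s, c n • chi a n) x * conj ((∑ m ∈ s, d m • chi a m) x) = ∑ n ∈ s, c n * conj (d n) := by
  have hpt : ∀ x : ℝ, (∑ n ∈ s, c n • chi a n) x * conj ((∑ m ∈ s, d m • chi a m) x) =
      ∑ n ∈ s, ∑ m ∈ s, c n * conj (d m) * (chi a n x * conj (chi a m x)) := by
    intro x
    rw [sum_smul_chi_apply, sum_smul_chi_apply, map_sum, Finset.sum_mul_sum]
    refine Finset.sum_congr rfl fun n _ ↦ Finset.sum_congr rfl fun m _ ↦ ?_
    rw [map_mul]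
    ring
  simp_rw [hpt]
  have hI : ∀ n m : ℤ, Integrable fun x ↦ c n * conj (d m) * (chi a n x * conj (chi a m x)) :=
    fun n m ↦ (integrable_chi_mul_conj_chi n m).const_mul _
  rw [integral_finsetSum _ fun n _ ↦ integrable_finsetSum _ fun m _ ↦ hI n m]
  refine Finset.sum_congr rfl fun n hn ↦ ?_
  rw [integral_finsetSum _ fun m _ ↦ hI n m]
  have e : ∀ m ∈ s, ∫ x, c n * conj (d m) * (chi a n x * conj (chi a m x)) =
      if n = m then c n * conj (d m) else 0 := by
    intro m _
    rw [MeasureTheory.integral_const_mul, integral_chi_mul_conj_chi ha, mul_ite, mul_one, mul_zero]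
  rw [Finset.sum_congr rfl e, Finset.sum_ite_eq]
  simp [hn]

/-- `(2a)^{-1/2}·(2a)^{-1/2} = (2a)^{-1}` in `ℂ` (`a > 0`). -/
theorem inv_sqrt_two_mul_sq (ha : 0 < a) :
    ((1 / Real.sqrt (2 * a) : ℝ) : ℂ) * ((1 / Real.sqrt (2 * a) : ℝ) : ℂ) = 1 / (2 * (a : ℂ)) := by
  rw [← Complex.ofReal_mul, div_mul_div_comm, one_mul, Real.mul_self_sqrt (by positivity)]
  push_cast
  ring

/-- **`∫ proj_P φ · conj(proj_P ψ) = Σ_{|n|≤P} ĉ_n(φ) conj ĉ_n(ψ) / (2a)`** (`a > 0`). -/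
theorem integral_proj_mul_conj_proj (ha : 0 < a) (P : ℕ) (φ ψ : ℝ → ℂ) :
    ∫ x, proj a P φ x * conj (proj a P ψ x) =
      ∑ n ∈ modes P, Yoshida1992.fourierCoeff a n φ * conj (Yoshida1992.fourierCoeff a n ψ) / (2 * (a : ℂ)) := by
  unfold proj
  rw [integral_sum_smul_chi_mul_conj ha]
  refine Finset.sum_congr rfl fun n _ ↦ ?_
  rw [map_mul, Complex.conj_ofReal]
  calc ((1 / Real.sqrt (2 * a) : ℝ) : ℂ) * Yoshida1992.fourierCoeff a n φ *
        (((1 / Real.sqrt (2 * a) : ℝ) : ℂ) * conj (Yoshida1992.fourierCoeff a n ψ))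
      = (((1 / Real.sqrt (2 * a) : ℝ) : ℂ) * ((1 / Real.sqrt (2 * a) : ℝ) : ℂ)) *
          (Yoshida1992.fourierCoeff a n φ * conj (Yoshida1992.fourierCoeff a n ψ)) := by ring
    _ = _ := by rw [inv_sqrt_two_mul_sq ha]; ring

/-! ## The limit `P → ∞` -/

/-- Pointwise convergence of the truncated Fourier series on the closed window (summable class). -/
theorem tendsto_proj_apply (ha : 0 < a) (hcont : ContinuousOn φ (Icc (-a) a)) (hend : φ (-a) = φ a)
    (hsum : Summable fun n : ℤ ↦ ‖Yoshida1992.fourierCoeff a n φ‖) {x : ℝ} (hx : x ∈ Icc (-a) a) :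
    Tendsto (fun P ↦ proj a P φ x) atTop (𝓝 (φ x)) := by
  rw [tendsto_iff_norm_sub_tendsto_zero]
  refine squeeze_zero (fun P ↦ norm_nonneg _) (fun P ↦ ?_) (tendsto_tsum_compl_modes a φ)
  rw [proj_apply_of_mem ha P φ hx, norm_sub_rev]
  exact norm_sub_trigPoly_le_of_summable ha hcont hend hsum P hx

/-- The index sets `modes P` exhaust `ℤ` (as a filter statement). -/
theorem tendsto_modes_atTop' : Tendsto modes atTop atTop := by
  refine Monotone.tendsto_atTop_atTop (fun M N h ↦ ?_) fun s ↦ ?_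
  · intro n hn
    rw [mem_modes] at hn ⊢
    exact hn.trans (by exact_mod_cast h)
  · refine ⟨(s.sup fun n ↦ n.natAbs), fun n hn ↦ mem_modes.2 ?_⟩
    have h := Finset.le_sup (f := fun n : ℤ ↦ n.natAbs) hn
    rw [← Int.natCast_natAbs]
    exact_mod_cast h

/-- **`∫ proj_P φ · conj(proj_P ψ) → ∫ φ conj ψ`** for windows of the summable class (`a > 0`; dominated convergence with
the uniform bound `Σ|ĉ|/(2a)` on the window). -/
theorem tendsto_integral_proj_mul_conj_proj (ha : 0 < a)
    (hzφ : ∀ x, x ∉ Icc (-a) a → φ x = 0) (hcφ : ContinuousOn φ (Icc (-a) a)) (heφ : φ (-a) = φ a)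
    (hsφ : Summable fun n : ℤ ↦ ‖Yoshida1992.fourierCoeff a n φ‖)
    (hcψ : ContinuousOn ψ (Icc (-a) a)) (heψ : ψ (-a) = ψ a)
    (hsψ : Summable fun n : ℤ ↦ ‖Yoshida1992.fourierCoeff a n ψ‖) :
    Tendsto (fun P ↦ ∫ x, proj a P φ x * conj (proj a P ψ x)) atTop (𝓝 (∫ x, φ x * conj (ψ x))) := by
  set Sφ : ℝ := ∑' n : ℤ, ‖Yoshida1992.fourierCoeff a n φ‖ / (2 * a) with hSφ
  set Sψ : ℝ := ∑' n : ℤ, ‖Yoshida1992.fourierCoeff a n ψ‖ / (2 * a) with hSψ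
  refine tendsto_integral_of_dominated_convergence (fun x ↦ (Icc (-a) a).indicator (fun _ ↦ Sφ * Sψ) x)
    (fun P ↦ ?_) ?_ (fun P ↦ Eventually.of_forall fun x ↦ ?_) (Eventually.of_forall fun x ↦ ?_)
  · exact ((isWindowFunction_proj ha P φ).measurable.mul
      (Complex.continuous_conj.measurable.comp (isWindowFunction_proj ha P ψ).measurable)).aestronglyMeasurable
  · exact (integrable_indicator_iff measurableSet_Icc).2 (integrableOn_const (by simp [Real.volume_Icc]))
  · by_cases hx : x ∈ Icc (-a) a
    · rw [indicator_of_mem hx, norm_mul, Complex.norm_conj, proj_apply_of_mem ha P φ hx, proj_apply_of_mem ha P ψ hx]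
      exact mul_le_mul (norm_trigPoly_le ha hsφ P x) (norm_trigPoly_le ha hsψ P x) (norm_nonneg _)
        ((norm_nonneg _).trans (norm_trigPoly_le ha hsφ P x))
    · rw [indicator_of_notMem hx, proj_apply_of_not_mem ha P φ hx, zero_mul, norm_zero]
  · by_cases hx : x ∈ Icc (-a) a
    · exact (tendsto_proj_apply ha hcφ heφ hsφ hx).mul
        ((Complex.continuous_conj.tendsto _).comp (tendsto_proj_apply ha hcψ heψ hsψ hx))
    · have e : (fun P ↦ proj a P φ x * conj (proj a P ψ x)) = fun _ ↦ 0 := by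
        funext P; rw [proj_apply_of_not_mem ha P φ hx, zero_mul]
      rw [e, hzφ x hx, zero_mul]
      exact tendsto_const_nhds

/-- **Convergence of the partial Parseval sums**: `Σ_{|n|≤P} ĉ_n(φ) conj ĉ_n(ψ)/(2a) → ∫ φ conj ψ` (`a > 0`, summable class). -/
theorem tendsto_sum_modes_fourierCoeff_mul_conj (ha : 0 < a)
    (hzφ : ∀ x, x ∉ Icc (-a) a → φ x = 0) (hcφ : ContinuousOn φ (Icc (-a) a)) (heφ : φ (-a) = φ a)
    (hsφ : Summable fun n : ℤ ↦ ‖Yoshida1992.fourierCoeff a n φ‖)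
    (hcψ : ContinuousOn ψ (Icc (-a) a)) (heψ : ψ (-a) = ψ a)
    (hsψ : Summable fun n : ℤ ↦ ‖Yoshida1992.fourierCoeff a n ψ‖) :
    Tendsto (fun P ↦ ∑ n ∈ modes P,
        Yoshida1992.fourierCoeff a n φ * conj (Yoshida1992.fourierCoeff a n ψ) / (2 * (a : ℂ))) atTop
      (𝓝 (∫ x, φ x * conj (ψ x))) := by
  have h := tendsto_integral_proj_mul_conj_proj ha hzφ hcφ heφ hsφ hcψ heψ hsψ
  simp_rw [integral_proj_mul_conj_proj ha] at h
  exact h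

/-- The Parseval terms are absolutely summable (summable class). -/
theorem summable_fourierCoeff_mul_conj (a : ℝ)
    (hsφ : Summable fun n : ℤ ↦ ‖Yoshida1992.fourierCoeff a n φ‖)
    (hsψ : Summable fun n : ℤ ↦ ‖Yoshida1992.fourierCoeff a n ψ‖) :
    Summable fun n : ℤ ↦ Yoshida1992.fourierCoeff a n φ * conj (Yoshida1992.fourierCoeff a n ψ) / (2 * (a : ℂ)) := by
  refine Summable.of_norm_bounded (g := fun n ↦ ‖Yoshida1992.fourierCoeff a n φ‖ *
    ((∑' m : ℤ, ‖Yoshida1992.fourierCoeff a m ψ‖) * ‖(1 / (2 * (a : ℂ)))‖)) (hsφ.mul_right _) fun n ↦ ?_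
  rw [div_eq_mul_one_div, norm_mul, norm_mul, Complex.norm_conj, mul_assoc]
  refine mul_le_mul_of_nonneg_left (mul_le_mul_of_nonneg_right ?_ (norm_nonneg _)) (norm_nonneg _)
  exact hsψ.le_tsum n fun m _ ↦ norm_nonneg _

/-- **Parseval for the summable window class** (`a > 0`): `Σ_{n∈ℤ} ĉ_n(φ) conj ĉ_n(ψ) / (2a) = ∫ φ conj ψ`. -/
theorem hasSum_fourierCoeff_mul_conj (ha : 0 < a)
    (hzφ : ∀ x, x ∉ Icc (-a) a → φ x = 0) (hcφ : ContinuousOn φ (Icc (-a) a)) (heφ : φ (-a) = φ a)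
    (hsφ : Summable fun n : ℤ ↦ ‖Yoshida1992.fourierCoeff a n φ‖)
    (hcψ : ContinuousOn ψ (Icc (-a) a)) (heψ : ψ (-a) = ψ a)
    (hsψ : Summable fun n : ℤ ↦ ‖Yoshida1992.fourierCoeff a n ψ‖) :
    HasSum (fun n : ℤ ↦ Yoshida1992.fourierCoeff a n φ * conj (Yoshida1992.fourierCoeff a n ψ) / (2 * (a : ℂ)))
      (∫ x, φ x * conj (ψ x)) := by
  have hs := summable_fourierCoeff_mul_conj a hsφ hsψ
  have h0 : Tendsto (fun s : Finset ℤ ↦ ∑ n ∈ s,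
      Yoshida1992.fourierCoeff a n φ * conj (Yoshida1992.fourierCoeff a n ψ) / (2 * (a : ℂ))) atTop
      (𝓝 (∑' n : ℤ, Yoshida1992.fourierCoeff a n φ * conj (Yoshida1992.fourierCoeff a n ψ) / (2 * (a : ℂ)))) :=
    hs.hasSum
  have h1 := h0.comp tendsto_modes_atTop'
  have h2 := tendsto_sum_modes_fourierCoeff_mul_conj ha hzφ hcφ heφ hsφ hcψ heψ hsψ
  have e := tendsto_nhds_unique h1 h2
  rw [← e]
  exact hs.hasSum

end Summit.RiemannHypothesis.RiemannHypothesis.Theorems.WeilFormatC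

end
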